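import Summits.Ventures.PercRepro.C041BlockMapFourCores
import Summits.Ventures.PercRepro.C041TriDomMonotoneInjection

/-!
# ROW C-041 — THE FIRST OPEN CORE IN THE KERNEL: `K₂,₃` with the marks on the three-side satisfies CONJECTURE
(STOCHASTIC DOMINATION) (p6, gen 48; P6-TWOEXIT-LEAN.md §53 ADDENDUM 22 cont. 6)

After THEOREM (ONE MARK EDGE) the open core of the conjecture on `≤ 5` vertices is `K₂,₃` with the marks `x, y, z`
on the three-side (`k23`: the marks `0, 1, 2`, the unmarked pair `3, 4`, the six edges `x–u, x–v, y–u, y–v, z–u,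
z–v`; `T = 13`, `A = (2, 2, 2)`) and its one-chord extension.  Here the conjecture is decided for `k23` in the
kernel: the six crossed colourings are listed (`cycCrossed_k23`: the statuses of every colouring by `Rd_iff_conn` /
`Mg_iff_conn` of `C041BlockMapReachBound` in `≤ 4` steps, a `decide` per colouring), the red-ward injection `φ23`
into `(⊤,⊥)` is exhibited (`topBot_k23_img`, `φ23_le`, `φ23_inj`), and `cycDomination_iff_injection` turns it into
the up-set statement `cycDomination_k23`.
-/

namespace PercRepro

namespace ZoneZ

namespace MultiExit

open ZoneData Pendant Finset

/-- `K₂,₃` with the marks `0, 1, 2` on the three-side and the unmarked vertices `3, 4`: the edges `0–3, 0–4, 1–3,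
1–4, 2–3, 2–4`. -/
def k23 : ZoneData (Fin 5) (Fin 6) Empty Empty where
  fst := ![0, 0, 1, 1, 2, 2]
  snd := ![3, 4, 3, 4, 3, 4]
  at₁ := Empty.elim
  at₂ := Empty.elim

set_option synthInstance.maxSize 400000 in
set_option synthInstance.maxHeartbeats 400000 in
set_option maxHeartbeats 8000000 in
/-- **The crossed colourings of `K₂,₃`**: exactly six (two in each cyclic class). -/
theorem cycCrossed_k23 (b : Fin 6 → Bool) : CycCrossed k23 0 1 2 b ↔
    b = ![true, false, true, true, false, false] ∨ b = ![false, true, true, true, false, false] ∨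
    b = ![true, true, false, false, true, false] ∨ b = ![true, true, false, false, false, true] ∨
    b = ![false, false, true, false, true, true] ∨ b = ![false, false, false, true, true, true] := by
  unfold CycCrossed
  simp only [rsig, bsig, RdS_free, MgS_free, Prod.mk.injEq, decide_eq_true_eq, decide_eq_false_iff_not,
    Rd_iff_conn k23 (k := 4) (by simp), Mg_iff_conn k23 (k := 4) (by simp)]
  rw [fin6_eta b]
  generalize b 0 = b₀
  generalize b 1 = b₁
  generalize b 2 = b₂
  generalize b 3 = b₃
  generalize b 4 = b₄
  generalize b 5 = b₅
  simp only [Conn]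
  unfold cAdj ZoneData.Joins
  cases b₀ <;> cases b₁ <;> cases b₂ <;> cases b₃ <;> cases b₄ <;> cases b₅ <;> decide

set_option synthInstance.maxSize 400000 in
set_option synthInstance.maxHeartbeats 400000 in
set_option maxHeartbeats 8000000 in
/-- The six images of the injection lie in `(⊤,⊥)`. -/
theorem topBot_k23_img :
    TopBot k23 0 1 2 ![true, true, true, true, true, false] ∧
    TopBot k23 0 1 2 ![false, true, true, true, true, false] ∧
    TopBot k23 0 1 2 ![true, true, false, true, true, false] ∧
    TopBot k23 0 1 2 ![true, true, true, false, false, true] ∧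
    TopBot k23 0 1 2 ![false, true, true, false, true, true] ∧
    TopBot k23 0 1 2 ![true, false, false, true, true, true] := by
  unfold TopBot
  simp only [rsig, bsig, RdS_free, MgS_free, Prod.mk.injEq, decide_eq_true_eq, decide_eq_false_iff_not,
    Rd_iff_conn k23 (k := 4) (by simp), Mg_iff_conn k23 (k := 4) (by simp)]
  simp only [Conn]
  unfold cAdj ZoneData.Joins
  decide

/-- The red-ward injection of the six crossed colourings into `(⊤,⊥)`. -/
def φ23 (b : Fin 6 → Bool) : Fin 6 → Bool :=
  if b = ![true, false, true, true, false, false] then ![true, true, true, true, true, false]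
  else if b = ![false, true, true, true, false, false] then ![false, true, true, true, true, false]
  else if b = ![true, true, false, false, true, false] then ![true, true, false, true, true, false]
  else if b = ![true, true, false, false, false, true] then ![true, true, true, false, false, true]
  else if b = ![false, false, true, false, true, true] then ![false, true, true, false, true, true]
  else if b = ![false, false, false, true, true, true] then ![true, false, false, true, true, true]
  else b

/-- The six crossed colourings, as a list. -/
def crossed23 : List (Fin 6 → Bool) :=
  [![true, false, true, true, false, false], ![false, true, true, true, false, false],
    ![true, true, false, false, true, false], ![true, true, false, false, false, true],
    ![false, false, true, false, true, true], ![false, false, false, true, true, true]]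

set_option maxRecDepth 20000 in
/-- The injection is injective on the crossed colourings. -/
theorem φ23_inj : ∀ ω ∈ crossed23, ∀ ω' ∈ crossed23, φ23 ω = φ23 ω' → ω = ω' := by
  decide

/-- The injection only turns blue edges red. -/
theorem φ23_le : ∀ ω ∈ crossed23, LeCol ω (φ23 ω) := by
  unfold LeCol
  decide

/-- The images of the six crossed colourings. -/
theorem φ23_vals :
    φ23 ![true, false, true, true, false, false] = ![true, true, true, true, true, false] ∧
    φ23 ![false, true, true, true, false, false] = ![false, true, true, true, true, false] ∧
    φ23 ![true, true, false, false, true, false] = ![true, true, false, true, true, false] ∧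
    φ23 ![true, true, false, false, false, true] = ![true, true, true, false, false, true] ∧
    φ23 ![false, false, true, false, true, true] = ![false, true, true, false, true, true] ∧
    φ23 ![false, false, false, true, true, true] = ![true, false, false, true, true, true] := by
  decide

/-- A crossed colouring is in the list. -/
theorem mem_crossed23 {b : Fin 6 → Bool} (h : CycCrossed k23 0 1 2 b) : b ∈ crossed23 := by
  rw [cycCrossed_k23] at h
  simp only [crossed23, List.mem_cons, List.mem_nil_iff, or_false]
  exact h

open Classical in
/-- **THEOREM (`K₂,₃` SATISFIES THE CONJECTURE)**: on every up-set of colourings of `K₂,₃` with the marks on the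
three-side, the cyclic crossed classes are outnumbered by `(⊤,⊥)`. -/
theorem cycDomination_k23 : CycDomination k23 0 1 2 := by
  rw [cycDomination_iff_injection]
  refine ⟨φ23, ?_, ?_⟩
  · intro ω hω ω' hω' heq
    exact φ23_inj ω (mem_crossed23 hω) ω' (mem_crossed23 hω') heq
  · intro ω hω
    refine ⟨?_, φ23_le ω (mem_crossed23 hω)⟩
    rw [cycCrossed_k23] at hω
    obtain ⟨h1, h2, h3, h4, h5, h6⟩ := topBot_k23_img
    obtain ⟨v1, v2, v3, v4, v5, v6⟩ := φ23_vals
    rcases hω with rfl | rfl | rfl | rfl | rfl | rfl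
    · rw [v1]; exact h1
    · rw [v2]; exact h2
    · rw [v3]; exact h3
    · rw [v4]; exact h4
    · rw [v5]; exact h5
    · rw [v6]; exact h6

end MultiExit

end ZoneZ

end PercRepro
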